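import Summits.QuantumFields.YangMills.Theorems.AllWindowsColdBoxTorusGreenSupplement

/-!
# The image-sum kernel of a Dirichlet/Neumann box on the doubled torus
# (estimate (T) of STUB-PLAN-K1-24006 for LINE-18 stub K1 `DirKernelDipoleDecay`, crux `AllWindowsColdBox.BulkMidWindowSU2`,
# stmt-QuantumFields-24006 — part 1: reflections, signs, symmetries)

The scalar lattice Laplacians `L_μ` of the relative complex (STUB-PLAN-K1 §1(ii): Dirichlet beyond the faces `ν ≠ μ`, Neumann at the
outer ends of the outward normals) are reflection-exact: a Dirichlet direction with sites `1,…,M−1` is the odd extension about `0`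
(and `M`), a Neumann direction with sites `0,…,M−1` the even extension about `−1/2` (and `M − 1/2`), both of period `2M`
(`M = 2H + 2` for the cold box).  This file sets up the images on the torus `(ℤ/2Mℤ)^d` and the signed image sum of the tree's
zero-mode-removed torus Green function `G̃_{2M} = torusGreen`:
* `toTorus`, `refl` (the image `σ·c` of a torus point under a pattern `σ : Fin d → Bool` of flips: `c_ν ↦ −c_ν` in a Dirichlet
  direction, `c_ν ↦ −1 − c_ν` in a Neumann one), `sgn σ = (−1)^{#flipped Dirichlet directions}`, `imageSum c' w = ½ Σ_σ sgn(σ) G̃(w − σ·c')`,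
  `boxGreen y y' = imageSum (ι y') (ι y)`;
* `sum_sgn_eq_zero` — `Σ_σ sgn σ = 0` when there is a Dirichlet direction;
* `imageSum_reflect_mem` / `imageSum_reflect_not_mem` — the image sum is ODD under `w_ν ↦ −w_ν` for Dirichlet `ν` and EVEN under
  `w_ν ↦ −1 − w_ν` for Neumann `ν` (reindex `σ ↦ toggle ν σ`, reflection invariance of `G̃`); `imageSum_eq_zero_of_fixed` — it vanishes
  on the Dirichlet planes;
* `imageSum_laplacian` — `−Δ_T (imageSum c') = Σ_σ sgn(σ) δ_{σ·c'}` (the constants `L^{−d}` of `−Δ_T G̃ = 2(δ₀ − L^{−d})` cancel).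
Definitions + algebra only; standard axioms.

HONEST LABEL: helper toward one registered stub (K1, OPEN) of a critic-passed line on the R2ξ″ RECORD-rung crux 24006; no stub, crux, rung
or summit is proved here; the Yang–Mills mass gap is NOT proved by this file.
-/

set_option autoImplicit false

noncomputable section

open Finset ZMod
open scoped Real BigOperators

namespace Summit.QuantumFields.YangMills.Theorems.AllWindowsColdBox.BoxKernel

open Literature.Probability.LatticeModels

variable {d : ℕ}

/-! ## Reflections, signs and the image sum -/

/-- Integer points read on the torus of period `2M`. -/
def toTorus (M : ℕ) (y : Fin d → ℤ) : TorusSite d (2 * M) := fun ν => ((y ν : ℤ) : ZMod (2 * M))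

/-- The image of a torus point under the reflection pattern `σ`: in a Dirichlet direction (`ν ∈ Dset`) the flip is `c_ν ↦ −c_ν`
(odd reflection about `0`), in a Neumann direction it is `c_ν ↦ −1 − c_ν` (even reflection about `−1/2`). -/
def refl (M : ℕ) (Dset : Finset (Fin d)) (σ : Fin d → Bool) (c : TorusSite d (2 * M)) : TorusSite d (2 * M) :=
  fun ν => if σ ν then (if ν ∈ Dset then -c ν else -1 - c ν) else c ν

/-- The sign of a reflection pattern: `−1` for each flipped Dirichlet direction. -/
def sgn (Dset : Finset (Fin d)) (σ : Fin d → Bool) : ℝ := ∏ ν ∈ Dset, (if σ ν then (-1 : ℝ) else 1)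

/-- The signed image sum of the torus Green function for a source `c'`: `w ↦ ½ Σ_σ sgn(σ) G̃_{2M}(w − σ·c')`. -/
def imageSum (M : ℕ) [NeZero M] (Dset : Finset (Fin d)) (c' w : TorusSite d (2 * M)) : ℝ :=
  (1 / 2) * ∑ σ : Fin d → Bool, sgn Dset σ * torusGreen (w - refl M Dset σ c')

/-- The box Green function on integer points: `G_B(y, y') = ½ Σ_σ sgn(σ) G̃_{2M}(y − σ·y')`. -/
def boxGreen (M : ℕ) [NeZero M] (Dset : Finset (Fin d)) (y y' : Fin d → ℤ) : ℝ :=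
  imageSum M Dset (toTorus M y') (toTorus M y)

/-- Toggling one component of a reflection pattern. -/
def toggle (ν : Fin d) (σ : Fin d → Bool) : Fin d → Bool := Function.update σ ν (!σ ν)

/-- Toggling twice is the identity. -/
theorem toggle_toggle (ν : Fin d) (σ : Fin d → Bool) : toggle ν (toggle ν σ) = σ := by
  funext κ
  by_cases hκ : κ = ν
  · subst hκ; simp [toggle]
  · simp [toggle, Function.update_of_ne hκ]

/-- The toggled component is negated. -/
theorem toggle_apply_self (ν : Fin d) (σ : Fin d → Bool) : toggle ν σ ν = !σ ν := by simp [toggle]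

/-- The other components are unchanged. -/
theorem toggle_apply_of_ne {ν κ : Fin d} (h : κ ≠ ν) (σ : Fin d → Bool) : toggle ν σ κ = σ κ := by
  simp [toggle, Function.update_of_ne h]

/-- `sgn (toggle ν σ) = −sgn σ` for a Dirichlet direction. -/
theorem sgn_toggle_of_mem {Dset : Finset (Fin d)} {ν : Fin d} (hν : ν ∈ Dset) (σ : Fin d → Bool) :
    sgn Dset (toggle ν σ) = -sgn Dset σ := by
  unfold sgn
  rw [← Finset.mul_prod_erase _ _ hν, ← Finset.mul_prod_erase _ _ hν, toggle_apply_self]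
  have : ∏ κ ∈ Dset.erase ν, (if toggle ν σ κ then (-1 : ℝ) else 1) = ∏ κ ∈ Dset.erase ν, (if σ κ then (-1 : ℝ) else 1) :=
    Finset.prod_congr rfl fun κ hκ => by rw [toggle_apply_of_ne (Finset.ne_of_mem_erase hκ)]
  rw [this]
  cases σ ν <;> simp

/-- `sgn (toggle ν σ) = sgn σ` for a Neumann direction. -/
theorem sgn_toggle_of_not_mem {Dset : Finset (Fin d)} {ν : Fin d} (hν : ν ∉ Dset) (σ : Fin d → Bool) :
    sgn Dset (toggle ν σ) = sgn Dset σ := by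
  unfold sgn
  exact Finset.prod_congr rfl fun κ hκ => by rw [toggle_apply_of_ne (ne_of_mem_of_not_mem hκ hν)]

/-- The sign of the trivial pattern is `1`. -/
theorem sgn_false (Dset : Finset (Fin d)) : sgn Dset (fun _ => false) = 1 := by
  simp [sgn]

/-- **The signs cancel**: `Σ_σ sgn(σ) = 0` as soon as there is a Dirichlet direction. -/
theorem sum_sgn_eq_zero {Dset : Finset (Fin d)} (hD : Dset.Nonempty) : ∑ σ : Fin d → Bool, sgn Dset σ = 0 := by
  classical
  obtain ⟨ν₀, hν₀⟩ := hD
  have hsgn : ∀ σ : Fin d → Bool, sgn Dset σ = ∏ ν, (if ν ∈ Dset then (if σ ν then (-1 : ℝ) else 1) else 1) := by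
    intro σ
    unfold sgn
    rw [Finset.prod_ite_mem, Finset.univ_inter]
  simp_rw [hsgn]
  have hswap := (Finset.prod_univ_sum (fun _ : Fin d => (Finset.univ : Finset Bool))
    (fun ν b => if ν ∈ Dset then (if b then (-1 : ℝ) else 1) else 1))
  rw [Fintype.piFinset_univ] at hswap
  rw [← hswap]
  apply Finset.prod_eq_zero (Finset.mem_univ ν₀)
  simp [hν₀]

/-! ## The reflection symmetries of the image sum -/

variable {M : ℕ} [NeZero M] {Dset : Finset (Fin d)}

/-- Flipping the Dirichlet coordinate `ν` of the argument is the same as toggling `σ` (up to the reflection invariance of `G̃`). -/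
theorem torusGreen_arg_reflect_mem {ν : Fin d} (hν : ν ∈ Dset) (σ : Fin d → Bool) (c' w : TorusSite d (2 * M)) :
    torusGreen (Function.update w ν (-w ν) - refl M Dset σ c') = torusGreen (w - refl M Dset (toggle ν σ) c') := by
  rw [← torusGreen_reflect (w - refl M Dset (toggle ν σ) c') ν]
  congr 1
  funext κ
  by_cases hκ : κ = ν
  · subst hκ
    simp only [Function.update_self, Pi.sub_apply, refl, toggle_apply_self, if_pos hν]
    cases σ κ <;> simp only [Bool.not_false, Bool.not_true, Bool.false_eq_true, if_true, if_false] <;> ring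
  · simp [Function.update_of_ne hκ, refl, toggle_apply_of_ne hκ]

/-- Flipping the Neumann coordinate `ν` (`w_ν ↦ −1 − w_ν`) of the argument is the same as toggling `σ`. -/
theorem torusGreen_arg_reflect_not_mem {ν : Fin d} (hν : ν ∉ Dset) (σ : Fin d → Bool) (c' w : TorusSite d (2 * M)) :
    torusGreen (Function.update w ν (-1 - w ν) - refl M Dset σ c') = torusGreen (w - refl M Dset (toggle ν σ) c') := by
  rw [← torusGreen_reflect (w - refl M Dset (toggle ν σ) c') ν]
  congr 1
  funext κ
  by_cases hκ : κ = ν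
  · subst hκ
    simp only [Function.update_self, Pi.sub_apply, refl, toggle_apply_self, if_neg hν]
    cases σ κ <;> simp only [Bool.not_false, Bool.not_true, Bool.false_eq_true, if_true, if_false] <;> ring
  · simp [Function.update_of_ne hκ, refl, toggle_apply_of_ne hκ]

/-- **Odd symmetry in a Dirichlet direction**: `IS(…, −w_ν, …) = −IS(…, w_ν, …)`. -/
theorem imageSum_reflect_mem {ν : Fin d} (hν : ν ∈ Dset) (c' w : TorusSite d (2 * M)) :
    imageSum M Dset c' (Function.update w ν (-w ν)) = -imageSum M Dset c' w := by
  unfold imageSum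
  rw [← mul_neg, ← Finset.sum_neg_distrib]
  congr 1
  refine Finset.sum_nbij' (toggle ν) (toggle ν) (fun σ _ => Finset.mem_univ _) (fun σ _ => Finset.mem_univ _)
    (fun σ _ => toggle_toggle ν σ) (fun σ _ => toggle_toggle ν σ) (fun σ _ => ?_)
  rw [torusGreen_arg_reflect_mem hν, sgn_toggle_of_mem hν]
  ring

/-- **Even symmetry in a Neumann direction**: `IS(…, −1 − w_ν, …) = IS(…, w_ν, …)`. -/
theorem imageSum_reflect_not_mem {ν : Fin d} (hν : ν ∉ Dset) (c' w : TorusSite d (2 * M)) :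
    imageSum M Dset c' (Function.update w ν (-1 - w ν)) = imageSum M Dset c' w := by
  unfold imageSum
  congr 1
  refine Finset.sum_nbij' (toggle ν) (toggle ν) (fun σ _ => Finset.mem_univ _) (fun σ _ => Finset.mem_univ _)
    (fun σ _ => toggle_toggle ν σ) (fun σ _ => toggle_toggle ν σ) (fun σ _ => ?_)
  rw [torusGreen_arg_reflect_not_mem hν, sgn_toggle_of_not_mem hν]

/-- On the Dirichlet planes (`−w_ν = w_ν`) the image sum vanishes. -/
theorem imageSum_eq_zero_of_fixed {ν : Fin d} (hν : ν ∈ Dset) (c' w : TorusSite d (2 * M)) (hw : -w ν = w ν) :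
    imageSum M Dset c' w = 0 := by
  have h := imageSum_reflect_mem hν c' w
  rw [hw, Function.update_eq_self] at h
  linarith

/-! ## The torus Laplacian of the image sum -/

/-- **`−Δ_T` of the image sum is the signed sum of point masses at the images** (the constants `L^{−d}` cancel because `Σ sgn = 0`):
`Σ_μ (2·IS(w) − IS(w+e_μ) − IS(w−e_μ)) = Σ_σ sgn(σ)·[w = σ·c']`. -/
theorem imageSum_laplacian (hD : Dset.Nonempty) (c' w : TorusSite d (2 * M)) :
    ∑ μ : Fin d, (2 * imageSum M Dset c' w - imageSum M Dset c' (w + Pi.single μ 1) - imageSum M Dset c' (w - Pi.single μ 1)) =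
      ∑ σ : Fin d → Bool, sgn Dset σ * (if w = refl M Dset σ c' then 1 else 0) := by
  unfold imageSum
  have hterm : ∀ μ : Fin d,
      2 * ((1 / 2 : ℝ) * ∑ σ : Fin d → Bool, sgn Dset σ * torusGreen (w - refl M Dset σ c')) -
        (1 / 2 : ℝ) * (∑ σ : Fin d → Bool, sgn Dset σ * torusGreen (w + Pi.single μ 1 - refl M Dset σ c')) -
        (1 / 2 : ℝ) * (∑ σ : Fin d → Bool, sgn Dset σ * torusGreen (w - Pi.single μ 1 - refl M Dset σ c')) =
      (1 / 2 : ℝ) * ∑ σ : Fin d → Bool, sgn Dset σ *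
        (2 * torusGreen (w - refl M Dset σ c') - torusGreen (w - refl M Dset σ c' + Pi.single μ 1) -
          torusGreen (w - refl M Dset σ c' - Pi.single μ 1)) := by
    intro μ
    simp only [Finset.mul_sum, ← Finset.sum_sub_distrib]
    refine Finset.sum_congr rfl fun σ _ => ?_
    have e1 : w + (Pi.single μ 1 : TorusSite d (2 * M)) - refl M Dset σ c' =
        w - refl M Dset σ c' + (Pi.single μ 1 : TorusSite d (2 * M)) := by abel
    have e2 : w - (Pi.single μ 1 : TorusSite d (2 * M)) - refl M Dset σ c' =
        w - refl M Dset σ c' - (Pi.single μ 1 : TorusSite d (2 * M)) := by abel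
    rw [e1, e2]
    ring
  rw [Finset.sum_congr rfl fun μ _ => hterm μ, ← Finset.mul_sum, Finset.sum_comm]
  have hinner : ∀ σ : Fin d → Bool,
      ∑ μ : Fin d, sgn Dset σ * (2 * torusGreen (w - refl M Dset σ c') - torusGreen (w - refl M Dset σ c' + Pi.single μ 1) -
        torusGreen (w - refl M Dset σ c' - Pi.single μ 1)) =
      sgn Dset σ * (2 * (if w = refl M Dset σ c' then 1 else 0) - 2 / ((2 * M : ℕ) : ℝ) ^ d) := by
    intro σ
    rw [← Finset.mul_sum, torusGreen_laplacian]
    simp only [sub_eq_zero]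
  rw [Finset.sum_congr rfl fun σ _ => hinner σ]
  have hsplit : ∑ σ : Fin d → Bool, sgn Dset σ * (2 * (if w = refl M Dset σ c' then 1 else 0) - 2 / ((2 * M : ℕ) : ℝ) ^ d) =
      2 * ∑ σ : Fin d → Bool, sgn Dset σ * (if w = refl M Dset σ c' then 1 else 0) -
        (2 / ((2 * M : ℕ) : ℝ) ^ d) * ∑ σ : Fin d → Bool, sgn Dset σ := by
    rw [Finset.mul_sum, Finset.mul_sum, ← Finset.sum_sub_distrib]
    exact Finset.sum_congr rfl fun σ _ => by ring
  rw [hsplit, sum_sgn_eq_zero hD]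
  ring

end Summit.QuantumFields.YangMills.Theorems.AllWindowsColdBox.BoxKernel

end
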